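import Literature.NumberTheory.Automorphic.SeesawTorusCharacters
import Literature.NumberTheory.Automorphic.RelNormOneTorusLevel
import Literature.NumberTheory.Automorphic.IdelicDyadicUnfolding
import Mathlib.MeasureTheory.Integral.Prod
import HarnessLib

/-!
# `dt = du₁ du₂` on `[T] = [U(W₁)] × [U(W₂)]`: product measure and Fubini for the seesaw torus

Topic `NumberTheory/Automorphic`; namespace `Literature.NumberTheory.Automorphic` (sub-namespace `SeesawTorus`).
Continuation of `SeesawTorus` (`[T] ≃ₜ* [U(W₁)] × [U(W₂)]`, the Haar probability measures
`SeesawTorus.probHaarQuot K L = dt` and `probHaarRelNormOneQuot K L = du_j`) supplying the MEASURE half of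
"`[T] = [U(W₁)] × [U(W₂)]`":

* § 1 second countability of `U(W_j)(𝔸) = relNormOneIdeles K L`, `[U(W_j)]`, `T(𝔸)`, `[T]` (from the tree theorem
  `secondCountableTopology_ideleGroup`), so that `[U(W₁)] × [U(W₂)]` with the product σ-algebra is a Borel space and
  the Borel σ-algebra of `T(𝔸)` is the product σ-algebra (`SeesawTorus.measurableSpace_eq_prod`);
* § 2 **`dt = du₁ du₂`**: `(probHaarQuot K L).map (quotEquiv K L) = (du₁).prod (du₂)`
  (`SeesawTorus.map_quotEquiv_probHaarQuot`, uniqueness of the Haar probability measure), measure preservation in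
  both directions, the marginals `dt ↦ du_j`;
* § 3 **Fubini on `[T]`**: `∫_{[T]} F dt = ∫_{[U(W₁)]} ∫_{[U(W₂)]} F(u₁u₂) du₂ du₁` for integrable (in particular
  continuous) `F` (`SeesawTorus.integral_eq_integral_integral`, both orders), product integrands split
  (`integral_fst_mul_snd`), and the toric period against a character `ξ = χ′₁ ⊠ χ′₂`:
  `∫_{[T]} F ξ dt = ∫∫ F(u₁u₂) χ′₁(u₁) χ′₂(u₂) du₂ du₁` (`SeesawTorus.integral_mul_charPair`, `integral_mul_char`).

Everything is proved (Mathlib + tree); no named facts.  Port of the HodgeCM publication cell's `PerL34/SeesawFubini`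
(2026-08-18), with its instance hypothesis `[SecondCountableTopology 𝔸_L]` DISCHARGED by the tree
(`secondCountableTopology_adeleRing`).  References: A. Weil, *Basic Number Theory* (1967), Ch. VII § 3
[cite: WeilBNT1967, Ch. VII §3]; folklore (Fubini for Haar probability measures on compact groups).
-/

set_option autoImplicit false

noncomputable section

open _root_.MeasureTheory _root_.Topology _root_.Set _root_.Function
open NumberField IsDedekindDomain

namespace Literature.NumberTheory.Automorphic

/-! ## § 1. Second countability -/

section SecondCountable

variable (K L : Type) [Field K] [Field L] [NumberField K] [NumberField L] [Algebra K L]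

/-- `U(W_j)(𝔸) = U(1)_{L/K}(𝔸_K)` is second countable (`𝕀_L` is). [folklore] -/
instance secondCountableTopology_relNormOneIdeles : SecondCountableTopology (relNormOneIdeles K L) := by
  haveI := secondCountableTopology_ideleGroup L
  exact (Topology.IsEmbedding.subtypeVal :
    Topology.IsEmbedding (Subtype.val : relNormOneIdeles K L → GaloisRepresentations.ideleGroup L))
      |>.secondCountableTopology

/-- `[U(W_j)]` is second countable. [folklore] -/
instance secondCountableTopology_relNormOneQuot :
    SecondCountableTopology (relNormOneIdeles K L ⧸ relNormOneRat K L) :=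
  inferInstance

/-- `[U(W₁)] × [U(W₂)]` with the product σ-algebra is a Borel space (this is where second countability enters).
[folklore] -/
instance borelSpace_relNormOneQuot_prod :
    BorelSpace ((relNormOneIdeles K L ⧸ relNormOneRat K L) × (relNormOneIdeles K L ⧸ relNormOneRat K L)) :=
  inferInstance

namespace SeesawTorus

/-- `T(𝔸)` is second countable. [folklore] -/
instance secondCountableTopology : SecondCountableTopology (SeesawTorus K L) :=
  inferInstanceAs (SecondCountableTopology (relNormOneIdeles K L × relNormOneIdeles K L))

/-- `[T]` is second countable. [folklore] -/
instance secondCountableTopology_quot : SecondCountableTopology (SeesawTorus K L ⧸ rat K L) :=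
  inferInstance

/-- The Borel σ-algebra of `T(𝔸)` (the one `SeesawTorus` carries) IS the product σ-algebra of the two Borel
factors. [folklore] -/
theorem measurableSpace_eq_prod :
    (instMeasurableSpace K L : MeasurableSpace (SeesawTorus K L)) =
      (Prod.instMeasurableSpace : MeasurableSpace (relNormOneIdeles K L × relNormOneIdeles K L)) :=
  (BorelSpace.measurable_eq (α := relNormOneIdeles K L × relNormOneIdeles K L)).symm

/-- Hence a map into `T(𝔸)` is measurable iff its two components are. [folklore] -/
theorem measurable_iff {X : Type} [MeasurableSpace X] (f : X → SeesawTorus K L) :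
    Measurable f ↔ Measurable (fun x => fst K L (f x)) ∧ Measurable (fun x => snd K L (f x)) := by
  have h := measurableSpace_eq_prod K L
  constructor
  · intro hf
    exact ⟨(continuous_fst K L).measurable.comp hf, (continuous_snd K L).measurable.comp hf⟩
  · rintro ⟨h₁, h₂⟩
    have h12 : Measurable[_, Prod.instMeasurableSpace]
        (fun x => ((fst K L (f x), snd K L (f x)) : relNormOneIdeles K L × relNormOneIdeles K L)) := h₁.prodMk h₂
    rw [measurable_iff_comap_le] at h12 ⊢
    rw [h]
    exact h12

end SeesawTorus

end SecondCountable

/-! ## § 2. `dt = du₁ du₂` -/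

namespace SeesawTorus

section ProductMeasure

variable (K L : Type) [Field K] [Field L] [NumberField K] [NumberField L] [Algebra K L]

/-- `quotEquiv` as a measurable equivalence `[T] ≃ᵐ [U(W₁)] × [U(W₂)]`. [folklore] -/
def quotMeasurableEquiv : (SeesawTorus K L ⧸ rat K L) ≃ᵐ
    (relNormOneIdeles K L ⧸ relNormOneRat K L) × (relNormOneIdeles K L ⧸ relNormOneRat K L) :=
  (quotEquiv K L).toHomeomorph.toMeasurableEquiv

/-- Values of `quotMeasurableEquiv` (definitional). [folklore] -/
@[simp] theorem quotMeasurableEquiv_apply (q : SeesawTorus K L ⧸ rat K L) :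
    quotMeasurableEquiv K L q = (quotFst K L q, quotSnd K L q) := rfl

/-- Values of the inverse (definitional). [folklore] -/
theorem quotMeasurableEquiv_symm_apply
    (p : (relNormOneIdeles K L ⧸ relNormOneRat K L) × (relNormOneIdeles K L ⧸ relNormOneRat K L)) :
    (quotMeasurableEquiv K L).symm p = quotInl K L p.1 * quotInr K L p.2 := rfl

/-- `du₁ du₂` is a Haar measure on `[U(W₁)] × [U(W₂)]`. [folklore] -/
instance isHaarMeasure_prod :
    ((probHaarRelNormOneQuot K L).prod (probHaarRelNormOneQuot K L)).IsHaarMeasure :=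
  inferInstance

/-- `du₁ du₂` is a probability measure. [folklore] -/
instance isProbabilityMeasure_prod :
    IsProbabilityMeasure ((probHaarRelNormOneQuot K L).prod (probHaarRelNormOneQuot K L)) :=
  inferInstance

/-- **`dt = du₁ du₂`** along the group isomorphism `quotMulEquiv` (uniqueness of Haar probability measures).
[folklore] -/
theorem map_quotMulEquiv_probHaarQuot :
    (probHaarQuot K L).map (quotMulEquiv K L) = (probHaarRelNormOneQuot K L).prod (probHaarRelNormOneQuot K L) := by
  haveI : ((probHaarQuot K L).map (quotMulEquiv K L)).IsHaarMeasure :=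
    MulEquiv.isHaarMeasure_map
      (H := (relNormOneIdeles K L ⧸ relNormOneRat K L) × (relNormOneIdeles K L ⧸ relNormOneRat K L))
      (probHaarQuot K L) (quotMulEquiv K L) (continuous_quotMulEquiv K L) (continuous_quotMulEquiv_symm K L)
  haveI : IsProbabilityMeasure ((probHaarQuot K L).map (quotMulEquiv K L)) :=
    Measure.isProbabilityMeasure_map (continuous_quotMulEquiv K L).measurable.aemeasurable
  exact Measure.isHaarMeasure_eq_of_isProbabilityMeasure _ _

/-- `dt = du₁ du₂` along the topological-group isomorphism `quotEquiv : [T] ≃ₜ* [U(W₁)] × [U(W₂)]`. [folklore] -/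
theorem map_quotEquiv_probHaarQuot :
    (probHaarQuot K L).map (quotEquiv K L) = (probHaarRelNormOneQuot K L).prod (probHaarRelNormOneQuot K L) :=
  map_quotMulEquiv_probHaarQuot K L

/-- `quotEquiv` preserves the measures `dt`, `du₁ du₂`. [folklore] -/
theorem measurePreserving_quotMeasurableEquiv :
    MeasurePreserving (quotMeasurableEquiv K L) (probHaarQuot K L)
      ((probHaarRelNormOneQuot K L).prod (probHaarRelNormOneQuot K L)) :=
  ⟨(quotMeasurableEquiv K L).measurable, map_quotMulEquiv_probHaarQuot K L⟩

/-- The same for `quotEquiv` itself. [folklore] -/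
theorem measurePreserving_quotEquiv :
    MeasurePreserving (quotEquiv K L) (probHaarQuot K L)
      ((probHaarRelNormOneQuot K L).prod (probHaarRelNormOneQuot K L)) :=
  measurePreserving_quotMeasurableEquiv K L

/-- … and for the inverse. [folklore] -/
theorem measurePreserving_quotMeasurableEquiv_symm :
    MeasurePreserving (quotMeasurableEquiv K L).symm
      ((probHaarRelNormOneQuot K L).prod (probHaarRelNormOneQuot K L)) (probHaarQuot K L) :=
  (measurePreserving_quotMeasurableEquiv K L).symm _

/-- `du₁ du₂` pushed to `[T]` by `(u₁, u₂) ↦ [(u₁, 1)]·[(1, u₂)]` is `dt`. [folklore] -/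
theorem map_inl_mul_inr_prod :
    ((probHaarRelNormOneQuot K L).prod (probHaarRelNormOneQuot K L)).map
        (fun p => quotInl K L p.1 * quotInr K L p.2) = probHaarQuot K L :=
  (measurePreserving_quotMeasurableEquiv_symm K L).map_eq

/-- `[T] → [U(W₁)]` preserves the Haar probability measures … [folklore] -/
theorem measurePreserving_quotFst :
    MeasurePreserving (quotFst K L) (probHaarQuot K L) (probHaarRelNormOneQuot K L) :=
  (measurePreserving_fst (μ := probHaarRelNormOneQuot K L) (ν := probHaarRelNormOneQuot K L)).comp
    (measurePreserving_quotMeasurableEquiv K L)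

/-- … and so does `[T] → [U(W₂)]`. [folklore] -/
theorem measurePreserving_quotSnd :
    MeasurePreserving (quotSnd K L) (probHaarQuot K L) (probHaarRelNormOneQuot K L) :=
  (measurePreserving_snd (μ := probHaarRelNormOneQuot K L) (ν := probHaarRelNormOneQuot K L)).comp
    (measurePreserving_quotMeasurableEquiv K L)

/-- The marginal of `dt` under `[T] → [U(W₁)]` is `du₁`. [folklore] -/
theorem map_quotFst_probHaarQuot : (probHaarQuot K L).map (quotFst K L) = probHaarRelNormOneQuot K L :=
  (measurePreserving_quotFst K L).map_eq

/-- The marginal of `dt` under `[T] → [U(W₂)]` is `du₂`. [folklore] -/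
theorem map_quotSnd_probHaarQuot : (probHaarQuot K L).map (quotSnd K L) = probHaarRelNormOneQuot K L :=
  (measurePreserving_quotSnd K L).map_eq

end ProductMeasure

/-! ## § 3. Fubini on `[T]` -/

section Fubini

variable (K L : Type) [Field K] [Field L] [NumberField K] [NumberField L] [Algebra K L]
variable {E : Type} [NormedAddCommGroup E] [NormedSpace ℝ E]

/-- Change of variables along `[T] ≃ [U(W₁)] × [U(W₂)]`: `∫_{[T]} g(t₁, t₂) dt = ∫ g d(du₁ du₂)`. [folklore] -/
theorem integral_comp_quotEquiv
    (g : (relNormOneIdeles K L ⧸ relNormOneRat K L) × (relNormOneIdeles K L ⧸ relNormOneRat K L) → E) :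
    ∫ q, g (quotFst K L q, quotSnd K L q) ∂probHaarQuot K L =
      ∫ p, g p ∂(probHaarRelNormOneQuot K L).prod (probHaarRelNormOneQuot K L) :=
  (measurePreserving_quotMeasurableEquiv K L).integral_comp (quotMeasurableEquiv K L).measurableEmbedding g

/-- `∫_{[T]} F dt = ∫ F(u₁u₂) d(du₁ du₂)` with `u₁u₂ := [(u₁, 1)]·[(1, u₂)]`. [folklore] -/
theorem integral_eq_integral_prod (F : SeesawTorus K L ⧸ rat K L → E) :
    ∫ q, F q ∂probHaarQuot K L =
      ∫ p, F (quotInl K L p.1 * quotInr K L p.2) ∂(probHaarRelNormOneQuot K L).prod (probHaarRelNormOneQuot K L) := by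
  rw [← (measurePreserving_quotMeasurableEquiv_symm K L).integral_comp
    (quotMeasurableEquiv K L).symm.measurableEmbedding F]
  rfl

omit [NormedSpace ℝ E] in
/-- Integrability transfers along `[T] ≃ [U(W₁)] × [U(W₂)]`. [folklore] -/
theorem integrable_prod_iff (F : SeesawTorus K L ⧸ rat K L → E) :
    Integrable (fun p : (relNormOneIdeles K L ⧸ relNormOneRat K L) × (relNormOneIdeles K L ⧸ relNormOneRat K L) =>
        F (quotInl K L p.1 * quotInr K L p.2)) ((probHaarRelNormOneQuot K L).prod (probHaarRelNormOneQuot K L)) ↔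
      Integrable F (probHaarQuot K L) :=
  (measurePreserving_quotMeasurableEquiv_symm K L).integrable_comp_emb
    (quotMeasurableEquiv K L).symm.measurableEmbedding (g := F)

omit [NormedSpace ℝ E] in
/-- A continuous function on the compact group `[T]` is `dt`-integrable. [folklore] -/
theorem integrable_of_continuous {F : SeesawTorus K L ⧸ rat K L → E} (hF : Continuous F) :
    Integrable F (probHaarQuot K L) :=
  hF.integrable_of_hasCompactSupport (HasCompactSupport.of_compactSpace F)

/-- **Fubini on `[T] = [U(W₁)] × [U(W₂)]`**: `∫_{[T]} F dt = ∫_{[U(W₁)]} ∫_{[U(W₂)]} F(u₁u₂) du₂ du₁` for every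
`dt`-integrable `F`. [folklore] -/
theorem integral_eq_integral_integral (F : SeesawTorus K L ⧸ rat K L → E) (hF : Integrable F (probHaarQuot K L)) :
    ∫ q, F q ∂probHaarQuot K L =
      ∫ u₁, ∫ u₂, F (quotInl K L u₁ * quotInr K L u₂) ∂probHaarRelNormOneQuot K L ∂probHaarRelNormOneQuot K L := by
  rw [integral_eq_integral_prod, integral_prod _ ((integrable_prod_iff K L F).mpr hF)]

/-- The other order: `∫_{[T]} F dt = ∫_{[U(W₂)]} ∫_{[U(W₁)]} F(u₁u₂) du₁ du₂`. [folklore] -/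
theorem integral_eq_integral_integral_symm (F : SeesawTorus K L ⧸ rat K L → E)
    (hF : Integrable F (probHaarQuot K L)) :
    ∫ q, F q ∂probHaarQuot K L =
      ∫ u₂, ∫ u₁, F (quotInl K L u₁ * quotInr K L u₂) ∂probHaarRelNormOneQuot K L ∂probHaarRelNormOneQuot K L := by
  rw [integral_eq_integral_prod, integral_prod_symm _ ((integrable_prod_iff K L F).mpr hF)]

/-- The continuous case ("all integrals over compact sets of continuous functions"). [folklore] -/
theorem integral_eq_integral_integral_of_continuous (F : SeesawTorus K L ⧸ rat K L → E) (hF : Continuous F) :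
    ∫ q, F q ∂probHaarQuot K L =
      ∫ u₁, ∫ u₂, F (quotInl K L u₁ * quotInr K L u₂) ∂probHaarRelNormOneQuot K L ∂probHaarRelNormOneQuot K L :=
  integral_eq_integral_integral K L F (integrable_of_continuous K L hF)

/-- Functions of the first variable: `∫_{[T]} f(t₁) dt = ∫_{[U(W₁)]} f du₁`. [folklore] -/
theorem integral_comp_quotFst (f : relNormOneIdeles K L ⧸ relNormOneRat K L → E) :
    ∫ q, f (quotFst K L q) ∂probHaarQuot K L = ∫ u, f u ∂probHaarRelNormOneQuot K L := by
  have h := integral_comp_quotEquiv K L (fun p => f p.1)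
  simp only at h
  rw [h, integral_fun_fst, probReal_univ, one_smul]

/-- Functions of the second variable: `∫_{[T]} f(t₂) dt = ∫_{[U(W₂)]} f du₂`. [folklore] -/
theorem integral_comp_quotSnd (f : relNormOneIdeles K L ⧸ relNormOneRat K L → E) :
    ∫ q, f (quotSnd K L q) ∂probHaarQuot K L = ∫ u, f u ∂probHaarRelNormOneQuot K L := by
  have h := integral_comp_quotEquiv K L (fun p => f p.2)
  simp only at h
  rw [h, integral_fun_snd, probReal_univ, one_smul]

/-- Product integrands split: `∫_{[T]} f(t₁) g(t₂) dt = (∫_{[U(W₁)]} f du₁)(∫_{[U(W₂)]} g du₂)`. [folklore] -/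
theorem integral_fst_mul_snd (f g : relNormOneIdeles K L ⧸ relNormOneRat K L → ℂ) :
    ∫ q, f (quotFst K L q) * g (quotSnd K L q) ∂probHaarQuot K L =
      (∫ u, f u ∂probHaarRelNormOneQuot K L) * (∫ u, g u ∂probHaarRelNormOneQuot K L) := by
  rw [← integral_prod_mul]
  exact integral_comp_quotEquiv K L (fun p => f p.1 * g p.2)

variable {K L}

/-- `(χ′₁ ⊠ χ′₂)(u₁u₂) = χ′₁(u₁) χ′₂(u₂)` read in `ℂ`. [folklore] -/
theorem coe_charPair_quotInl_mul_quotInr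
    (ξ₁ ξ₂ : ContinuousMonoidHom (relNormOneIdeles K L ⧸ relNormOneRat K L) Circle)
    (u₁ u₂ : relNormOneIdeles K L ⧸ relNormOneRat K L) :
    ((charPair ξ₁ ξ₂ (quotInl K L u₁ * quotInr K L u₂) : Circle) : ℂ) = (ξ₁ u₁ : ℂ) * (ξ₂ u₂ : ℂ) := by
  rw [map_mul, Circle.coe_mul, charPair_apply, charPair_apply, quotFst_quotInl, quotSnd_quotInl, quotFst_quotInr,
    quotSnd_quotInr, map_one, map_one, mul_one, one_mul]

/-- A character is a bounded continuous weight: `F · ξ` is integrable when `F` is. [folklore] -/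
theorem integrable_mul_coe_char {G : Type} [Group G] [TopologicalSpace G] [MeasurableSpace G]
    [OpensMeasurableSpace G] {μ : Measure G} {F : G → ℂ} (hF : Integrable F μ) (ξ : ContinuousMonoidHom G Circle) :
    Integrable (fun g => F g * (ξ g : ℂ)) μ :=
  hF.mul_bdd (c := 1) ((continuous_subtype_val.comp ξ.continuous).aestronglyMeasurable)
    (Filter.Eventually.of_forall fun g => (Circle.norm_coe (ξ g)).le)

variable (K L)

/-- **The toric period over `[T]` as an iterated integral**:
`∫_{[T]} F(t) (χ′₁ ⊠ χ′₂)(t) dt = ∫_{[U(W₁)]} ∫_{[U(W₂)]} F(u₁u₂) χ′₁(u₁) χ′₂(u₂) du₂ du₁` for `dt`-integrable `F`.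
[folklore] -/
theorem integral_mul_charPair (F : SeesawTorus K L ⧸ rat K L → ℂ) (hF : Integrable F (probHaarQuot K L))
    (ξ₁ ξ₂ : ContinuousMonoidHom (relNormOneIdeles K L ⧸ relNormOneRat K L) Circle) :
    ∫ q, F q * (charPair ξ₁ ξ₂ q : ℂ) ∂probHaarQuot K L =
      ∫ u₁, ∫ u₂, F (quotInl K L u₁ * quotInr K L u₂) * ((ξ₁ u₁ : ℂ) * (ξ₂ u₂ : ℂ))
        ∂probHaarRelNormOneQuot K L ∂probHaarRelNormOneQuot K L := by
  rw [integral_eq_integral_integral K L _ (integrable_mul_coe_char hF (charPair ξ₁ ξ₂))]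
  simp only [coe_charPair_quotInl_mul_quotInr]

/-- The continuous case of `integral_mul_charPair`. [folklore] -/
theorem integral_mul_charPair_of_continuous (F : SeesawTorus K L ⧸ rat K L → ℂ) (hF : Continuous F)
    (ξ₁ ξ₂ : ContinuousMonoidHom (relNormOneIdeles K L ⧸ relNormOneRat K L) Circle) :
    ∫ q, F q * (charPair ξ₁ ξ₂ q : ℂ) ∂probHaarQuot K L =
      ∫ u₁, ∫ u₂, F (quotInl K L u₁ * quotInr K L u₂) * ((ξ₁ u₁ : ℂ) * (ξ₂ u₂ : ℂ))
        ∂probHaarRelNormOneQuot K L ∂probHaarRelNormOneQuot K L :=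
  integral_mul_charPair K L F (integrable_of_continuous K L hF) ξ₁ ξ₂

/-- Every character `ξ` of `[T]`: `∫_{[T]} F ξ dt = ∫∫ F(u₁u₂) χ′₁(u₁) χ′₂(u₂) du₂ du₁` with `(χ′₁, χ′₂) := ξ`.
[folklore] -/
theorem integral_mul_char (F : SeesawTorus K L ⧸ rat K L → ℂ) (hF : Integrable F (probHaarQuot K L))
    (ξ : ContinuousMonoidHom (SeesawTorus K L ⧸ rat K L) Circle) :
    ∫ q, F q * (ξ q : ℂ) ∂probHaarQuot K L =
      ∫ u₁, ∫ u₂, F (quotInl K L u₁ * quotInr K L u₂) * ((charFst ξ u₁ : ℂ) * (charSnd ξ u₂ : ℂ))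
        ∂probHaarRelNormOneQuot K L ∂probHaarRelNormOneQuot K L := by
  rw [← integral_mul_charPair K L F hF]
  rw [charPair_charFst_charSnd]

end Fubini

end SeesawTorus

end Literature.NumberTheory.Automorphic

end
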